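import Summits.AtomisticToContinuum.HydrodynamicLimit.Theorems.BoxDissipativeWeakStrongRelativeEnergyStabilityTimeZero
import Literature.MathematicalPhysics.KineticTheory.HardSphereEulerProofs
import HarnessLib

/-!
# Crux `RelativeEnergyStability` (stmt-AtomisticToContinuum-17653), line `registered`:
helpers of the stub `stub_clampedRelEnergyCoercive` (S3') — the box states of a configuration

Configuration-wise facts about the box averages `Û(w, x) = (ρ̂, m̂, Ê)` (`RES.boxState`) that feed the pointwise
coercivity estimate of S3':

* `co_box_variance`, `co_box_admissible` (registered helper sub-goal) — the variance identity
  `(N+1)⁻¹ Σ K(x,qᵢ) ‖vᵢ − V‖²/2 = Ê − ⟨m̂, V⟩ + ρ̂‖V‖²/2`; hence `ρ̂ ≥ 0`, vacuum boxes carry no momentum/energy,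
  the internal energy `Ê − |m̂|²/(2ρ̂)` is `≥ 0`, and it vanishes with `ρ̂ > 0` only if all particles in the box
  share one velocity — for configurations with pairwise distinct velocities the box then holds exactly one
  particle and `ρ̂ ≤ ((N+1)ℓ³)⁻¹`;
* `co_volume_sharedVel`, `co_ae_distinctVel` — configurations with two equal velocities form a Lebesgue-null
  (hyperplane) set, preserved in measure by the hard-sphere flow (`HardSphereFlow.measurePreserving`) and
  hence null under the local Gibbs law at every time (`localGibbsMeasure_absolutelyContinuous`);
* `co_integrable_clampedRelEnergy` — for one configuration the clamped box relative energy is integrable in the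
  centre `x` (the box state takes finitely many values, indexed by the occupancy pattern, and `ℰ_Z(x, V)` is
  continuous in `x` for each value `V`).

References: BrezinaFeireisl2018 §3.1–3.2; Spohn1991 Part I Ch. 3.
-/

noncomputable section

namespace Summit.AtomisticToContinuum.HydrodynamicLimit.Theorems.RES

open MeasureTheory Filter Set
open scoped ENNReal Topology
open Summit.AtomisticToContinuum.HydrodynamicLimit.Theses.BoxDissipativeWeakStrong
open Literature.MathematicalPhysics.KineticTheory Literature.Analysis.FluidPDE
open Literature.Analysis.FluidPDE.CompressibleEuler
open Literature.Analysis.FluidPDE.CompressibleEuler.EulerPhase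

variable {N : ℕ}

/-! ## The variance identity and admissibility of box states -/

/-- **Variance identity**: `(N+1)⁻¹ Σ K(x,qᵢ) ‖vᵢ − V‖²/2 = Ê − ⟨m̂, V⟩ + ρ̂ ‖V‖²/2` for every `V`. -/
theorem co_box_variance (l : ℝ) (w : Config (N + 1) (Fin 3) T3) (x : T3) (V : V3) :
    ((N + 1 : ℕ) : ℝ)⁻¹ * ∑ i, boxKernel l x (w i).1 * (‖(w i).2 - V‖ ^ 2 / 2) =
      empiricalEnergyField w (boxKernel l x) - inner ℝ (empiricalMomentumField w (boxKernel l x)) V +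
        empiricalDensityField w (boxKernel l x) * (‖V‖ ^ 2 / 2) := by
  have hpt : ∀ i : Fin (N + 1), boxKernel l x (w i).1 * (‖(w i).2 - V‖ ^ 2 / 2) =
      boxKernel l x (w i).1 * (‖(w i).2‖ ^ 2 / 2) - boxKernel l x (w i).1 * inner ℝ (w i).2 V +
        boxKernel l x (w i).1 * (‖V‖ ^ 2 / 2) := by
    intro i; rw [norm_sub_sq_real]; ring
  simp_rw [hpt]
  rw [Finset.sum_add_distrib, Finset.sum_sub_distrib, ← Finset.sum_mul, empiricalEnergyField_eq_sum,
    empiricalMomentumField_eq_sum, empiricalDensityField_eq_sum, real_inner_smul_left, sum_inner]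
  simp_rw [real_inner_smul_left]
  ring

/-- Off the vacuum the internal energy of the box state is a weighted velocity variance:
`Ê − |m̂|²/(2ρ̂) = (N+1)⁻¹ Σ K(x,qᵢ) ‖vᵢ − v̄‖²/2`, `v̄ = m̂/ρ̂`. -/
theorem co_box_ien_eq (l : ℝ) (w : Config (N + 1) (Fin 3) T3) (x : T3)
    (hρ : empiricalDensityField w (boxKernel l x) ≠ 0) :
    (boxState l w x).2.2 - ‖(boxState l w x).2.1‖ ^ 2 / (2 * (boxState l w x).1) =
      ((N + 1 : ℕ) : ℝ)⁻¹ * ∑ i, boxKernel l x (w i).1 *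
        (‖(w i).2 - (empiricalDensityField w (boxKernel l x))⁻¹ • empiricalMomentumField w (boxKernel l x)‖ ^ 2
          / 2) := by
  rw [co_box_variance, real_inner_smul_right, real_inner_self_eq_norm_sq, norm_smul, norm_inv,
    Real.norm_eq_abs, mul_pow, inv_pow, sq_abs]
  simp only [boxState]
  field_simp
  ring

/-- The box kernel of one configuration has at most one non-zero weight when all particles in the box share
the mean velocity and the velocities are pairwise distinct; then `Σ K(x,qᵢ) ≤ ℓ⁻³`. -/
theorem co_sum_boxKernel_le {l : ℝ} (hl : 0 ≤ l) (w : Config (N + 1) (Fin 3) T3) (x : T3) {v : V3}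
    (hdist : ∀ i j, i ≠ j → (w i).2 ≠ (w j).2) (hv : ∀ i, boxKernel l x (w i).1 = 0 ∨ (w i).2 = v) :
    ∑ i, boxKernel l x (w i).1 ≤ (l ^ 3)⁻¹ := by
  by_cases h : ∃ i, boxKernel l x (w i).1 ≠ 0
  · obtain ⟨i₀, hi₀⟩ := h
    have hvi₀ : (w i₀).2 = v := (hv i₀).resolve_left hi₀
    rw [Finset.sum_eq_single i₀ (fun j _ hj => ?_) (fun h => absurd (Finset.mem_univ i₀) h)]
    · exact LGFS.boxK_le hl x _
    · rcases hv j with hj0 | hjv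
      · exact hj0
      · exact absurd (hjv.trans hvi₀.symm) (hdist j i₀ hj)
  · push Not at h
    rw [Finset.sum_eq_zero fun i _ => h i]
    positivity

/-- **Admissibility of the box states of a configuration with pairwise distinct velocities** (registered
helper sub-goal): `ρ̂ ≥ 0`; a vacuum box carries no momentum and no energy; the internal energy
`Ê − |m̂|²/(2ρ̂)` is `≥ 0`; and if it vanishes while `ρ̂ > 0` then the box holds one particle:
`ρ̂ ≤ ((N+1) ℓ³)⁻¹`. -/
theorem co_box_admissible {N : ℕ} {l : ℝ} (hl : 0 ≤ l) (w : Config (N + 1) (Fin 3) T3) (hdist : ∀ i j, i ≠ j → (w i).2 ≠ (w j).2) (x : T3) : 0 ≤ (boxState l w x).1 ∧ ((boxState l w x).1 = 0 → (boxState l w x).2.1 = 0 ∧ (boxState l w x).2.2 = 0) ∧ 0 ≤ (boxState l w x).2.2 - ‖(boxState l w x).2.1‖ ^ 2 / (2 * (boxState l w x).1) ∧ (0 < (boxState l w x).1 → (boxState l w x).2.2 - ‖(boxState l w x).2.1‖ ^ 2 / (2 * (boxState l w x).1) = 0 → (boxState l w x).1 ≤ ((N : ℝ) + 1)⁻¹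 * (l ^ 3)⁻¹) := by
  have hK0 : ∀ i, 0 ≤ boxKernel l x (w i).1 := fun i => LGFS.boxK_nonneg hl x _
  have hn : (0 : ℝ) < ((N + 1 : ℕ) : ℝ) := by positivity
  have hρ : (boxState l w x).1 = ((N + 1 : ℕ) : ℝ)⁻¹ * ∑ i, boxKernel l x (w i).1 := by
    simp only [boxState, empiricalDensityField_eq_sum]
  have hvac : (boxState l w x).1 = 0 → (boxState l w x).2.1 = 0 ∧ (boxState l w x).2.2 = 0 := by
    intro h0
    rw [hρ, mul_eq_zero] at h0
    have hsum : ∑ i, boxKernel l x (w i).1 = 0 := h0.resolve_left (inv_ne_zero hn.ne')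
    have hall : ∀ i, boxKernel l x (w i).1 = 0 := fun i =>
      (Finset.sum_eq_zero_iff_of_nonneg fun j _ => hK0 j).1 hsum i (Finset.mem_univ i)
    simp only [boxState, empiricalMomentumField_eq_sum, empiricalEnergyField_eq_sum, hall, zero_smul,
      Finset.sum_const_zero, smul_zero, zero_mul, mul_zero, and_self]
  refine ⟨by rw [hρ]; exact mul_nonneg (inv_nonneg.2 hn.le) (Finset.sum_nonneg fun i _ => hK0 i), hvac,
    ?_, ?_⟩
  · by_cases h0 : (boxState l w x).1 = 0
    · obtain ⟨hm, hE⟩ := hvac h0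
      rw [hm, hE, h0]; simp
    · rw [co_box_ien_eq l w x h0]
      exact mul_nonneg (inv_nonneg.2 hn.le) (Finset.sum_nonneg fun i _ => mul_nonneg (hK0 i) (by positivity))
  · intro hpos hE
    rw [co_box_ien_eq l w x hpos.ne', mul_eq_zero] at hE
    have hsum := hE.resolve_left (inv_ne_zero hn.ne')
    have hall := (Finset.sum_eq_zero_iff_of_nonneg fun j _ => mul_nonneg (hK0 j) (by positivity)).1 hsum
    have hv : ∀ i, boxKernel l x (w i).1 = 0 ∨ (w i).2 =
        (empiricalDensityField w (boxKernel l x))⁻¹ • empiricalMomentumField w (boxKernel l x) := by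
      intro i
      rcases mul_eq_zero.1 (hall i (Finset.mem_univ i)) with h | h
      · exact Or.inl h
      · right
        have h2 : ‖(w i).2 - (empiricalDensityField w (boxKernel l x))⁻¹ •
            empiricalMomentumField w (boxKernel l x)‖ ^ 2 = 0 := by linarith
        exact sub_eq_zero.1 (norm_eq_zero.1 (pow_eq_zero_iff two_ne_zero |>.1 h2))
    rw [hρ, Nat.cast_add_one]
    exact mul_le_mul_of_nonneg_left (co_sum_boxKernel_le hl w x hdist hv) (inv_nonneg.2 (by positivity))

/-! ## Configurations with two equal velocities are null, at every time -/

/-- The velocity hyperplanes `{v_i = v_j}`, `i ≠ j`, are Lebesgue-null in phase space. -/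
theorem co_volume_sharedVel (n : ℕ) :
    volume {w : Config n (Fin 3) T3 | ∃ i j, i ≠ j ∧ (w i).2 = (w j).2} = 0 := by
  have hsub : {w : Config n (Fin 3) T3 | ∃ i j, i ≠ j ∧ (w i).2 = (w j).2} ⊆
      ⋃ i, ⋃ j, {w : Config n (Fin 3) T3 | i ≠ j ∧ (w i).2 = (w j).2} := by
    intro w hw
    simpa only [mem_iUnion, mem_setOf_eq] using hw
  refine measure_mono_null hsub (measure_iUnion_null fun i => measure_iUnion_null fun j => ?_)
  by_cases hij : i = j
  · simp [hij]
  · have hset : {w : Config n (Fin 3) T3 | i ≠ j ∧ (w i).2 = (w j).2} =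
        (MeasurableEquiv.arrowProdEquivProdArrow T3 V3 (Fin n)) ⁻¹'
          (univ ×ˢ {v : Fin n → V3 | v i = v j}) := by
      ext w
      simp [hij, MeasurableEquiv.arrowProdEquivProdArrow, Equiv.arrowProdEquivProdArrow]
    have hLm : MeasurableSet {v : Fin n → V3 | v i = v j} :=
      measurableSet_eq_fun (measurable_pi_apply i) (measurable_pi_apply j)
    rw [hset, (volume_measurePreserving_arrowProdEquivProdArrow T3 V3 (Fin n)).measure_preimage
      (MeasurableSet.univ.prod hLm).nullMeasurableSet, Measure.volume_eq_prod, Measure.prod_prod]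
    have hL : volume {v : Fin n → V3 | v i = v j} = 0 := by
      have hLs : ({v : Fin n → V3 | v i = v j} : Set (Fin n → V3)) =
          (LinearMap.ker ((LinearMap.proj i : (Fin n → V3) →ₗ[ℝ] V3) - LinearMap.proj j) :
            Submodule ℝ (Fin n → V3)) := by
        ext v; simp [sub_eq_zero]
      rw [hLs]
      refine Measure.addHaar_submodule volume _ fun htop => ?_
      have hmem : (Pi.single i (EuclideanSpace.single (0 : Fin 3) (1 : ℝ)) : Fin n → V3) ∈
          LinearMap.ker ((LinearMap.proj i : (Fin n → V3) →ₗ[ℝ] V3) - LinearMap.proj j) :=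
        htop ▸ Submodule.mem_top
      have h1 : (Pi.single i (EuclideanSpace.single (0 : Fin 3) (1 : ℝ)) : Fin n → V3) i =
          (Pi.single i (EuclideanSpace.single (0 : Fin 3) (1 : ℝ)) : Fin n → V3) j := by
        simpa [sub_eq_zero] using hmem
      rw [Pi.single_eq_same, Pi.single_eq_of_ne (Ne.symm hij)] at h1
      have h2 := congrArg (fun e : V3 => e 0) h1
      simp at h2
    rw [hL, mul_zero]

/-- **Almost surely (local Gibbs law, any time `t`) the evolved configuration has pairwise distinct
velocities**: the shared-velocity set is Lebesgue-null and measurable, the flow preserves the Liouville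
measure, and the local Gibbs law is absolutely continuous with respect to it. -/
theorem co_ae_distinctVel {σ : ℝ} {a₀ θ₀ : T3 → ℝ} {u₀ : T3 → V3} (N : ℕ)
    (Φ : HardSphereFlow (Literature.Analysis.FluidPDE.Torus.geometry (Fin 3)) (hsDiameter σ N) (N + 1))
    (t : ℝ) :
    ∀ᵐ z ∂(localGibbsLaw σ a₀ u₀ θ₀ N Φ), ∀ i j, i ≠ j → (Φ.flow t z i).2 ≠ (Φ.flow t z j).2 := by
  have hS : MeasurableSet {w : Config (N + 1) (Fin 3) T3 | ∃ i j, i ≠ j ∧ (w i).2 = (w j).2} := by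
    have heq : {w : Config (N + 1) (Fin 3) T3 | ∃ i j, i ≠ j ∧ (w i).2 = (w j).2} =
        ⋃ i, ⋃ j, {w : Config (N + 1) (Fin 3) T3 | i ≠ j ∧ (w i).2 = (w j).2} := by
      ext w; simp only [mem_iUnion, mem_setOf_eq]
    rw [heq]
    refine MeasurableSet.iUnion fun i => MeasurableSet.iUnion fun j => ?_
    by_cases hij : i = j
    · simp [hij]
    · simp only [ne_eq, hij, not_false_eq_true, true_and]
      exact measurableSet_eq_fun (measurable_pi_apply i).snd (measurable_pi_apply j).snd
  have h0 : localGibbsLaw σ a₀ u₀ θ₀ N Φ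
      (Φ.flow t ⁻¹' {w : Config (N + 1) (Fin 3) T3 | ∃ i j, i ≠ j ∧ (w i).2 = (w j).2}) = 0 := by
    rw [localGibbsLaw_eq]
    refine localGibbsMeasure_absolutelyContinuous σ a₀ u₀ θ₀ N Φ ?_
    rw [(Φ.measurePreserving t).measure_preimage hS.nullMeasurableSet, liouville_eq]
    exact le_antisymm ((Measure.le_iff'.1 Measure.restrict_le_self _).trans (co_volume_sharedVel _).le)
      bot_le
  filter_upwards [measure_eq_zero_iff_ae_notMem.1 h0] with z hz i j hij heq
  exact hz ⟨i, j, hij, heq⟩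

/-! ## Integrability of the clamped box relative energy in the centre variable -/

/-- **The clamped box relative energy of one configuration is integrable in `x`** (continuous strong
fields with `μ_cut`, `p_cut` continuous along them): the box state takes finitely many values `F(o)` indexed by
the occupancy pattern `o ∈ {0,1}^{N+1}` (a measurable function of `x`), and `x ↦ ℰ_Z(F(o) | ·(x))` is
continuous for each `o`, so the integrand is measurable and bounded on the compact torus. -/
theorem co_integrable_clampedRelEnergy {σ η₁ a b l : ℝ} {r₀ θ₀ : T3 → ℝ} {u₀ : T3 → V3}
    (hu : Continuous u₀) (hθ : Continuous θ₀)
    (hμC : Continuous fun x => (cutEOS σ η₁).chemPotential (r₀ x) (θ₀ x))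
    (hpC : Continuous fun x => (cutEOS σ η₁).p (r₀ x) (θ₀ x)) (w : Config (N + 1) (Fin 3) T3) :
    Integrable fun x => clampedRelEnergy σ η₁ a b (r₀ x) (u₀ x) (θ₀ x) (boxState l w x) := by
  -- occupancy pattern and the finitely many values of the box state
  obtain ⟨occ, hocc⟩ : ∃ occ : T3 → (Fin (N + 1) → Bool),
      occ = fun x i => decide (∀ k, ‖(w i).1 k - x k‖ < l / 2) := ⟨_, rfl⟩
  obtain ⟨F, hF⟩ : ∃ F : (Fin (N + 1) → Bool) → BoxState, F = fun o =>
      (((N + 1 : ℕ) : ℝ)⁻¹ * ∑ i, (if o i = true then (l ^ 3)⁻¹ else 0),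
        ((N + 1 : ℕ) : ℝ)⁻¹ • ∑ i, (if o i = true then (l ^ 3)⁻¹ else (0 : ℝ)) • (w i).2,
        ((N + 1 : ℕ) : ℝ)⁻¹ * ∑ i, (if o i = true then (l ^ 3)⁻¹ else 0) * (‖(w i).2‖ ^ 2 / 2)) :=
    ⟨_, rfl⟩
  have hrepr : ∀ x, boxState l w x = F (occ x) := by
    intro x
    simp only [hF, hocc, boxState, empiricalDensityField_eq_sum, empiricalMomentumField_eq_sum,
      empiricalEnergyField_eq_sum, boxKernel, Set.indicator_apply, Set.mem_setOf_eq, decide_eq_true_eq]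
  have hoccm : Measurable occ := by
    rw [hocc]
    refine measurable_pi_lambda _ fun i => measurable_to_bool ?_
    have hset : (fun x : T3 => decide (∀ k, ‖(w i).1 k - x k‖ < l / 2)) ⁻¹' {true} =
        ⋂ k, {x : T3 | ‖(w i).1 k - x k‖ < l / 2} := by
      ext x; simp
    rw [hset]
    exact (isOpen_iInter_of_finite fun k => isOpen_lt (by fun_prop) continuous_const).measurableSet
  have hcont : ∀ V : BoxState, Continuous fun x => clampedRelEnergy σ η₁ a b (r₀ x) (u₀ x) (θ₀ x) V := by
    intro V
    simp only [tz_clampedRelEnergy_eq]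
    fun_prop
  -- measurability
  have hmeas : Measurable fun x => clampedRelEnergy σ η₁ a b (r₀ x) (u₀ x) (θ₀ x) (boxState l w x) := by
    have h1 : (fun x => clampedRelEnergy σ η₁ a b (r₀ x) (u₀ x) (θ₀ x) (boxState l w x)) =
        (fun p : T3 × (Fin (N + 1) → Bool) => clampedRelEnergy σ η₁ a b (r₀ p.1) (u₀ p.1) (θ₀ p.1) (F p.2)) ∘
          fun x => (x, occ x) := by
      funext x; simp only [Function.comp_apply, hrepr x]
    rw [h1]
    exact (measurable_from_prod_countable_left fun o => (hcont (F o)).measurable).comp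
      (measurable_id.prodMk hoccm)
  -- a uniform bound
  have hbd : ∀ o : Fin (N + 1) → Bool, ∃ B : ℝ, ∀ x,
      |clampedRelEnergy σ η₁ a b (r₀ x) (u₀ x) (θ₀ x) (F o)| ≤ B := by
    intro o
    obtain ⟨B, hB⟩ := isCompact_univ.exists_bound_of_continuousOn (hcont (F o)).continuousOn
    exact ⟨B, fun x => Real.norm_eq_abs _ ▸ hB x (mem_univ x)⟩
  choose B hB using hbd
  refine (integrable_const (∑ o, |B o|)).mono' hmeas.aestronglyMeasurable (ae_of_all _ fun x => ?_)
  rw [Real.norm_eq_abs, hrepr x]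
  exact ((hB (occ x) x).trans (le_abs_self _)).trans
    (Finset.single_le_sum (fun o _ => abs_nonneg (B o)) (Finset.mem_univ (occ x)))

end Summit.AtomisticToContinuum.HydrodynamicLimit.Theorems.RES

end
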